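import Literature.NumberTheory.EllipticCurves.NeronIsogenyScalingLayerReductionProofs
import Literature.NumberTheory.EllipticCurves.Isogeny
import Literature.NumberTheory.EllipticCurves.DivisionPolynomialTorsion
import HarnessLib

/-!
# A rational isogeny on the points over an unramified layer: level shift by the multiplier,
# surjectivity onto deep levels, and the counting inequality

`Proofs` file (theorems only, no definitions, no named facts) in topic
`NumberTheory/EllipticCurves`; third local step of the proof of the named fact
`Literature.NumberTheory.EllipticCurves.integral_neronScaling_of_isGloballyMinimal`
(`NeronIsogenyScaling.lean`) by counting points over the unramified layers `K_n = K_v(ζ)`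
(architecture: module docstring of `NeronIsogenyScalingProofs.lean`; local steps one and two:
`NeronIsogenyScalingLayerLevelsProofs`, `NeronIsogenyScalingLayerReductionProofs`).

Setting. `W, W'` are Weierstrass equations over the number field `K`, `φ : W → W'` an isogeny
(the tree's `WeierstrassCurve.Isogeny`: a `Γ_K`-equivariant homomorphism on `K̄`-points) whose
`x`-coordinate is `A(x)/B(x)` off a finite set `Bad ⊆ E(K̄)`, with `A, B ∈ K[X]`, `B` monic,
`deg A = deg B + 1` and leading coefficient `lc A = r⁻²` (`r ∈ Kˣ` is the MULTIPLIER: this is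
the shape produced from `qΛ ⊆ Λ'` by `exists_isogeny_x_eq_of_isNeronLatticeOf`). A `K`-embedding
`ι : K̄ → K̄_v` transports `E(K̄)` into `X(K̄_v)`, `X = W ⊗ K_v` (`pointsMapOfEmb`, `Sha.lean`,
followed by the identity transport `Affine.Point.congrEquiv`), equivariantly for
`resGalOfEmb ι : Γ_{K_v} → Γ_K`. Results (the "ALGEBRAIC layer points" are the `P ∈ E(K̄)` with
`ι_* P ∈ E(K_n)`):

* generic lemmas on polynomials over a valued field: dominance of the leading term
  (`val_eval_eq_of_forall_lt`, `exists_val_eval_eq`), **a root of prescribed size from the two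
  top coefficients** (`exists_isRoot_val_eq`, Newton polygon's last segment via Vieta), and
  algebraicity of roots (`mem_range_of_isRoot_map`);
* `emb_isogeny_mem_range` — **`φ` maps algebraic layer points to algebraic layer points**
  (Galois descent to `K_n`, `mem_adjoin_of_forall_smul_eq`);
* `exists_level_shift` — **level shift**: for algebraic `P ∈ E₁` deep enough,
  `φ P ∈ E₁'` and `|z(φP)|_v = |r|_v · |z(P)|_v` (`|A(x)/B(x)| = |r|⁻²|x|` for `|x|` large,
  `|x|·|z|² = 1` on `E₁`);
* `exists_deep_preimage` — **surjectivity onto deep levels with descent**: if `φ P₀` (`P₀` an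
  algebraic layer point) is deep in `E₁'`, then `φ P₀ = φ P₁` for an algebraic LAYER point `P₁`
  of `E₁` with `|z(P₁)| = |z(φP₀)|/|r|` (the large root of `A - x(φP₀)·B`, then Galois: the
  `Γ_{K_n}`-conjugates of `P₁` differ from it by elements of `ker φ` of arbitrarily deep level,
  hence vanish);
* `card_le_degree_mul_relIndex` — **the counting inequality**: a finite family of algebraic
  layer points of `W` pairwise inequivalent modulo the level `t/|r|` has at most
  `#ker φ · [E'(K_n) : E'⁽ᵗ⁾(K_n)]` members.

## References

* [SilvermanAEC2009] J. H. Silverman, *The Arithmetic of Elliptic Curves*, 2nd ed., GTM 106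
  (2009): III.4 (isogenies), IV.3–IV.6 and VII.2 (the formal group and `E₁`), VIII.§1.
* [SilvermanATAEC1994] J. H. Silverman, *Advanced Topics in the Arithmetic of Elliptic Curves*,
  GTM 151 (1994): IV.6.1 with IV.5.1 (what is being replaced: the Néron mapping property).

## Design

Theorems only (D-0026); setting, notation and hypotheses verbatim those of the two previous local
steps; local `notation3` for the transport `ι_*`, the curve `X ⊗ K̄_v` and the layer points.
-/

noncomputable section

open scoped Classical NNReal Pointwise
open NumberField IsDedekindDomain Polynomial

universe u

/-! ## Generic lemmas: polynomials over a valued field -/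

namespace Literature.NumberTheory.EllipticCurves

section Valued

variable {L : Type*} [Field L] (w : Valuation L ℝ≥0)

/-- **Dominance of the leading term**: if `|x| ≥ 1` and `|cᵢ| < |c_d|·|x|` for all lower
coefficients, then `|p(x)| = |c_d|·|x|ᵈ`. [folklore] -/
theorem val_eval_eq_of_forall_lt {p : L[X]} {x : L} (h1 : 1 ≤ w x)
    (h2 : ∀ i < p.natDegree, w (p.coeff i) < w p.leadingCoeff * w x) :
    w (p.eval x) = w p.leadingCoeff * w x ^ p.natDegree := by
  rcases Nat.eq_zero_or_pos p.natDegree with hd | hd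
  · rw [eq_C_of_natDegree_eq_zero hd, eval_C, leadingCoeff_C, natDegree_C, pow_zero, mul_one]
  rw [eval_eq_sum_range, Finset.sum_range_succ]
  have htop : w (p.coeff p.natDegree * x ^ p.natDegree) = w p.leadingCoeff * w x ^ p.natDegree := by
    rw [map_mul, map_pow, coeff_natDegree]
  have hx0 : 0 < w x := lt_of_lt_of_le zero_lt_one h1
  have hlc : 0 < w p.leadingCoeff :=
    pos_iff_ne_zero.mpr (left_ne_zero_of_mul (zero_le.trans_lt (h2 0 hd)).ne')
  have hlow : w (∑ i ∈ Finset.range p.natDegree, p.coeff i * x ^ i) <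
      w p.leadingCoeff * w x ^ p.natDegree := by
    refine Valuation.map_sum_lt w (mul_pos hlc (pow_pos hx0 _)).ne' fun i hi ↦ ?_
    rw [Finset.mem_range] at hi
    rw [map_mul, map_pow]
    calc w (p.coeff i) * w x ^ i < w p.leadingCoeff * w x * w x ^ i :=
          mul_lt_mul_of_pos_right (h2 i hi) (pow_pos hx0 _)
      _ = w p.leadingCoeff * w x ^ (i + 1) := by ring
      _ ≤ w p.leadingCoeff * w x ^ p.natDegree :=
          mul_le_mul_of_nonneg_left (pow_le_pow_right₀ h1 (by omega)) zero_le
  rw [Valuation.map_add_eq_of_lt_right _ (hlow.trans_eq htop.symm), htop]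

/-- `|p(x)| = |c_d|·|x|ᵈ` for all `|x|` large enough (`p ≠ 0`). [folklore] -/
theorem exists_val_eval_eq {p : L[X]} (hp : p ≠ 0) :
    ∃ M : ℝ≥0, ∀ x : L, M < w x → w (p.eval x) = w p.leadingCoeff * w x ^ p.natDegree := by
  have hlc : 0 < w p.leadingCoeff :=
    pos_iff_ne_zero.mpr ((Valuation.ne_zero_iff w).mpr (leadingCoeff_ne_zero.mpr hp))
  refine ⟨max 1 (((Finset.range p.natDegree).sup fun i ↦ w (p.coeff i)) / w p.leadingCoeff),
    fun x hx ↦ val_eval_eq_of_forall_lt w (le_of_max_le_left hx.le) fun i hi ↦ ?_⟩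
  have hB : (Finset.range p.natDegree).sup (fun i ↦ w (p.coeff i)) < w p.leadingCoeff * w x := by
    rw [mul_comm, ← div_lt_iff₀ hlc]; exact lt_of_le_of_lt (le_max_right _ _) hx
  exact lt_of_le_of_lt (Finset.le_sup (f := fun i ↦ w (p.coeff i)) (Finset.mem_range.mpr hi)) hB

/-- The valuation of a multiset sum is `< R` when every summand is. [folklore] -/
theorem val_multiset_sum_lt {S : Multiset L} {R : ℝ≥0} (hR : 0 < R) (h : ∀ s ∈ S, w s < R) :
    w S.sum < R := by
  induction S using Multiset.induction_on with
  | empty => rw [Multiset.sum_zero, map_zero]; exact hR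
  | cons a S ih =>
    rw [Multiset.sum_cons]
    exact Valuation.map_add_lt w (h a (Multiset.mem_cons_self a S))
      (ih fun s hs ↦ h s (Multiset.mem_cons_of_mem hs))

/-- **A root of prescribed size from the two top coefficients** (the last segment of the Newton
polygon): over an algebraically closed valued field, a polynomial of degree `e + 1` whose two top
coefficients satisfy `|c_{e+1}|·R = |c_e|` and whose lower coefficients satisfy
`|cᵢ|·Rⁱ < |c_e|·Rᵉ` has a root of valuation exactly `R`: no root is larger than `R` (the term
`c_{e+1}sᵉ⁺¹` would dominate), and not all roots are smaller (Vieta: `c_e = -c_{e+1}·Σ roots`).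
[folklore] -/
theorem exists_isRoot_val_eq [IsAlgClosed L] {p : L[X]} {e : ℕ} (he : p.natDegree = e + 1)
    {R : ℝ≥0} (hR : 0 < R) (htop : w p.leadingCoeff * R = w (p.coeff e))
    (hlow : ∀ i < e, w (p.coeff i) * R ^ i < w (p.coeff e) * R ^ e) :
    ∃ x : L, p.IsRoot x ∧ w x = R := by
  have hp0 : p ≠ 0 := by rintro rfl; rw [natDegree_zero] at he; exact Nat.succ_ne_zero e he.symm
  have hlc : 0 < w p.leadingCoeff :=
    pos_iff_ne_zero.mpr ((Valuation.ne_zero_iff w).mpr (leadingCoeff_ne_zero.mpr hp0))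
  have hcard : Multiset.card p.roots = p.natDegree := IsAlgClosed.card_roots_eq_natDegree
  -- (1) no root exceeds `R`
  have h1 : ∀ s ∈ p.roots, w s ≤ R := by
    intro s hs
    by_contra hlt
    rw [not_le] at hlt
    have hroot : p.eval s = 0 := (mem_roots hp0).mp hs
    have hs0 : 0 < w s := hR.trans hlt
    set u : ℝ≥0 := w s / R with hu_def
    have hu : 1 < u := by rw [hu_def, lt_div_iff₀ hR, one_mul]; exact hlt
    have hsu : w s = R * u := by rw [hu_def, mul_div_cancel₀ _ hR.ne']
    -- every term `i ≤ e` has valuation `≤ |c_e|·|s|ᵉ < |c_{e+1}|·|s|ᵉ⁺¹`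
    have hterm : ∀ i ≤ e, w (p.coeff i * s ^ i) ≤ w (p.coeff e) * w s ^ e := by
      intro i hi
      rw [map_mul, map_pow]
      rcases hi.lt_or_eq with hi | rfl
      · have := hlow i hi
        calc w (p.coeff i) * w s ^ i = w (p.coeff i) * R ^ i * u ^ i := by rw [hsu, mul_pow]; ring
          _ ≤ w (p.coeff e) * R ^ e * u ^ i := mul_le_mul_of_nonneg_right this.le zero_le
          _ ≤ w (p.coeff e) * R ^ e * u ^ e := mul_le_mul_of_nonneg_left (pow_le_pow_right₀ hu.le hi.le) zero_le
          _ = w (p.coeff e) * w s ^ e := by rw [hsu, mul_pow]; ring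
      · exact le_rfl
    have hlt_top : w (p.coeff e) * w s ^ e < w p.leadingCoeff * w s ^ (e + 1) := by
      calc w (p.coeff e) * w s ^ e = w p.leadingCoeff * R * w s ^ e := by rw [htop]
        _ < w p.leadingCoeff * w s * w s ^ e := by gcongr
        _ = w p.leadingCoeff * w s ^ (e + 1) := by ring
    have hsum : w (∑ i ∈ Finset.range (e + 1), p.coeff i * s ^ i) <
        w p.leadingCoeff * w s ^ (e + 1) :=
      Valuation.map_sum_lt w (mul_pos hlc (pow_pos hs0 _)).ne' fun i hi ↦
        (hterm i (Nat.lt_succ_iff.mp (Finset.mem_range.mp hi))).trans_lt hlt_top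
    have heval : w (p.eval s) = w p.leadingCoeff * w s ^ (e + 1) := by
      have htopv : w (p.coeff (e + 1) * s ^ (e + 1)) = w p.leadingCoeff * w s ^ (e + 1) := by
        rw [map_mul, map_pow, ← he, coeff_natDegree]
      rw [eval_eq_sum_range, he, Finset.sum_range_succ,
        Valuation.map_add_eq_of_lt_right _ (hsum.trans_eq htopv.symm), htopv]
    rw [hroot, map_zero] at heval
    exact (mul_pos hlc (pow_pos hs0 _)).ne' heval.symm
  -- (2) not all roots are smaller than `R` (Vieta for the coefficient of `Xᵉ`)
  have h2 : ∃ s ∈ p.roots, R ≤ w s := by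
    by_contra hall
    simp only [not_exists, not_and, not_le] at hall
    set Q : L[X] := (p.roots.map fun a ↦ X - C a).prod with hQ_def
    have hQ : C p.leadingCoeff * Q = p := C_leadingCoeff_mul_prod_multiset_X_sub_C hcard
    have hQdeg : Q.natDegree = e + 1 := by
      rw [hQ_def, natDegree_multiset_prod_X_sub_C_eq_card, hcard, he]
    have hQe : Q.coeff e = -p.roots.sum := by
      have h := multiset_prod_X_sub_C_nextCoeff p.roots
      rw [nextCoeff_of_natDegree_pos (by rw [← hQ_def, hQdeg]; exact Nat.succ_pos e)] at h
      rw [← hQ_def, hQdeg, Nat.add_sub_cancel] at h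
      exact h
    have hpe : p.coeff e = p.leadingCoeff * -p.roots.sum := by
      conv_lhs => rw [← hQ, coeff_C_mul, hQe]
    have hlt : w (p.coeff e) < w (p.coeff e) := by
      calc w (p.coeff e) = w p.leadingCoeff * w p.roots.sum := by rw [hpe, map_mul, Valuation.map_neg]
        _ < w p.leadingCoeff * R := by gcongr; exact val_multiset_sum_lt w hR hall
        _ = w (p.coeff e) := htop
    exact lt_irrefl _ hlt
  obtain ⟨s, hs, hRs⟩ := h2
  exact ⟨s, (mem_roots hp0).mp hs, le_antisymm (h1 s hs) hRs⟩

end Valued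

/-- **Roots in an extension of a polynomial over an algebraically closed field come from the
field**: if `p ∈ F[X]` is nonzero, `F` algebraically closed, `ι : F → E`, then every root of
`p.map ι` lies in the image of `ι` (`p` splits in `F`). [folklore] -/
theorem mem_range_of_isRoot_map {F E : Type*} [Field F] [Field E] [IsAlgClosed F] (ι : F →+* E)
    {p : F[X]} (hp : p ≠ 0) {x : E} (hx : (p.map ι).IsRoot x) : x ∈ Set.range ι := by
  have hroots := roots_map_of_injective_of_card_eq_natDegree ι.injective
    (IsAlgClosed.card_roots_eq_natDegree (p := p))
  have hx' : x ∈ (p.map ι).roots := (mem_roots (Polynomial.map_ne_zero hp)).mpr hx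
  rw [← hroots, Multiset.mem_map] at hx'
  obtain ⟨a, -, rfl⟩ := hx'
  exact ⟨a, rfl⟩


/-- Below a finite set of nonnegative reals there is a positive threshold separating `0` from
its nonzero members. [folklore] -/
theorem exists_pos_lt_of_finite {S : Set ℝ≥0} (hS : S.Finite) :
    ∃ t : ℝ≥0, 0 < t ∧ ∀ z ∈ S, z ≠ 0 → t < z := by
  let T : Finset ℝ≥0 := insert 1 (hS.toFinset.filter (· ≠ 0))
  have hT : T.Nonempty := ⟨1, Finset.mem_insert_self _ _⟩
  have hpos : 0 < T.min' hT := by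
    have hmem := T.min'_mem hT
    rcases Finset.mem_insert.mp hmem with h | h
    · rw [h]; exact one_pos
    · exact pos_iff_ne_zero.mpr (Finset.mem_filter.mp h).2
  refine ⟨T.min' hT / 2, div_pos hpos two_pos, fun z hz hz0 ↦ ?_⟩
  have hle : T.min' hT ≤ z :=
    T.min'_le z (Finset.mem_insert_of_mem (Finset.mem_filter.mpr ⟨hS.mem_toFinset.mpr hz, hz0⟩))
  exact (half_lt_self hpos).trans_le hle

end Literature.NumberTheory.EllipticCurves

/-! ## The local setting: transport of `E(K̄)` into `X(K̄_v)` along `ι : K̄ → K̄_v` -/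

namespace IsDedekindDomain.HeightOneSpectrum

open Literature.NumberTheory.EllipticCurves Literature.NumberTheory.GaloisRepresentations Field
  Literature.NumberTheory.EllipticCurves.FormalGroupChart

variable {K : Type u} [Field K] [NumberField K] {v : HeightOneSpectrum (𝓞 K)}
  {w : Valuation (AlgebraicClosure (v.adicCompletion K)) ℝ≥0}
  (hw : ∀ x, (w x : ℝ) = spectralNorm (v.adicCompletion K) (AlgebraicClosure (v.adicCompletion K)) x)
  {𝔐 : Ideal v.localAbsIntegers} (h𝔐 : 𝔐 ∈ v.localPrimesAbove)
  {n : ℕ} (hn : n ≠ 0) {ζ : AlgebraicClosure (v.adicCompletion K)}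
  (hζ : IsPrimitiveRoot ζ (Nat.card (IsLocalRing.ResidueField (v.adicCompletionIntegers K)) ^ n - 1))
  (W W' : WeierstrassCurve K)
  (ι : AlgebraicClosure K →ₐ[K] AlgebraicClosure (v.adicCompletion K))

/-- `K_v`. -/
local notation3 "𝕂" => v.adicCompletion K
/-- `K̄_v`. -/
local notation3 "𝕃" => AlgebraicClosure (v.adicCompletion K)
/-- `X ⊗ K̄_v` for `X = Y ⊗ K_v`. -/
local notation3 "V[" Y "]" =>
  WeierstrassCurve.baseChange (WeierstrassCurve.baseChange Y (v.adicCompletion K))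
    (AlgebraicClosure (v.adicCompletion K))
/-- The layer points `E(K_n) ≤ X(K̄_v)`. -/
local notation3 "Rg[" Y "]" => (WeierstrassCurve.Affine.Point.map
  (W' := WeierstrassCurve.baseChange Y (v.adicCompletion K))
  (IntermediateField.val (IntermediateField.adjoin (v.adicCompletion K) {ζ}))).range
/-- The transport `ι_* : E(K̄) →+ X(K̄_v)`. -/
local notation3 "ι⁎[" Y "]" => AddMonoidHom.comp
  (WeierstrassCurve.Affine.Point.congrEquiv
    (WeierstrassCurve.baseChange_baseChange_adicCompletion Y v).symm).toAddMonoidHom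
  (pointsMapOfEmb Y ι)

/-- Coordinates of a transported point are the `ι`-images. [folklore] -/
theorem nonsingular_emb {x y : AlgebraicClosure K}
    (h : (W.baseChange (AlgebraicClosure K)).toAffine.Nonsingular x y) :
    (V[W]).toAffine.Nonsingular (ι x) (ι y) := by
  rw [WeierstrassCurve.baseChange_baseChange_adicCompletion]
  exact (WeierstrassCurve.Affine.baseChange_nonsingular (W := W) (f := ι) ι.injective x y).mpr h

/-- `ι_* (x, y) = (ι x, ι y)`. [folklore] -/
theorem emb_some {x y : AlgebraicClosure K}
    (h : (W.baseChange (AlgebraicClosure K)).toAffine.Nonsingular x y) :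
    ι⁎[W] (.some x y h) = .some (ι x) (ι y) (nonsingular_emb W ι h) := by
  show WeierstrassCurve.Affine.Point.congrEquiv
      (WeierstrassCurve.baseChange_baseChange_adicCompletion W v).symm
      (WeierstrassCurve.Affine.Point.map ι (.some x y h)) = _
  rw [WeierstrassCurve.Affine.Point.map_some, WeierstrassCurve.Affine.Point.congrEquiv_some]

/-- `ι_*` is injective. [folklore] -/
theorem emb_injective : Function.Injective (ι⁎[W]) := fun _ _ h ↦
  pointsMapOfEmb_injective W ι ((WeierstrassCurve.Affine.Point.congrEquiv
    (WeierstrassCurve.baseChange_baseChange_adicCompletion W v).symm).injective h)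

/-- **Equivariance of `ι_*`** for the restriction `resGalOfEmb ι : Γ_{K_v} → Γ_K`:
`ι_*(σ|_{K̄} • P) = σ(ι_* P)` (`pointsMapOfEmb_smul`, `congrEquiv_smul`). [folklore] -/
theorem emb_smul (σ : absoluteGaloisGroup (v.adicCompletion K)) (P : W.geomPoints) :
    ι⁎[W] (resGalOfEmb ι σ • P) =
      WeierstrassCurve.Affine.Point.map ((absoluteGaloisGroup.toAlgEquiv _ σ : 𝕃 ≃ₐ[𝕂] 𝕃) :
        𝕃 →ₐ[𝕂] 𝕃) (ι⁎[W] P) :=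
  (congrArg (WeierstrassCurve.Affine.Point.congrEquiv
    (WeierstrassCurve.baseChange_baseChange_adicCompletion W v).symm) (pointsMapOfEmb_smul W ι σ P)).trans
    (WeierstrassCurve.congrEquiv_smul W v σ _)

/-- **Algebraicity of points with algebraic abscissa**: a point of `X(K̄_v)` whose
`x`-coordinate lies in `ι(K̄)` is the transport of a point of `E(K̄)` (`y` is a root of the
Weierstrass quadratic, a nonzero polynomial with coefficients in the algebraically closed field
`K̄`: `mem_range_of_isRoot_map`). [folklore] -/
theorem some_mem_range_emb {x y : 𝕃} (h : (V[W]).toAffine.Nonsingular x y)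
    (hx : x ∈ Set.range ι) : (.some x y h : (V[W]).toAffine.Point) ∈ (ι⁎[W]).range := by
  obtain ⟨a, rfl⟩ := hx
  -- `y` is a root of the Weierstrass quadratic at `a`
  let q : (AlgebraicClosure K)[X] := C 1 * X ^ 2 +
    C (algebraMap K (AlgebraicClosure K) W.a₁ * a + algebraMap K (AlgebraicClosure K) W.a₃) * X +
    C (-(a ^ 3 + algebraMap K (AlgebraicClosure K) W.a₂ * a ^ 2 +
      algebraMap K (AlgebraicClosure K) W.a₄ * a + algebraMap K (AlgebraicClosure K) W.a₆))
  have hqdeg : q.natDegree = 2 := natDegree_quadratic one_ne_zero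
  have hq0 : q ≠ 0 := fun h0 ↦ by rw [h0, natDegree_zero] at hqdeg; exact two_ne_zero hqdeg.symm
  have he : (W.baseChange 𝕃).toAffine.Equation (ι a) y := by
    rw [← WeierstrassCurve.baseChange_baseChange_adicCompletion]; exact h.1
  have e₁ : (W.baseChange 𝕃).toAffine.a₁ = algebraMap K 𝕃 W.a₁ := rfl
  have e₂ : (W.baseChange 𝕃).toAffine.a₂ = algebraMap K 𝕃 W.a₂ := rfl
  have e₃ : (W.baseChange 𝕃).toAffine.a₃ = algebraMap K 𝕃 W.a₃ := rfl
  have e₄ : (W.baseChange 𝕃).toAffine.a₄ = algebraMap K 𝕃 W.a₄ := rfl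
  have e₆ : (W.baseChange 𝕃).toAffine.a₆ = algebraMap K 𝕃 W.a₆ := rfl
  have hcoef : ∀ b : K, ι (algebraMap K (AlgebraicClosure K) b) = algebraMap K 𝕃 b :=
    fun b ↦ ι.commutes b
  have hroot : (q.map (ι : AlgebraicClosure K →+* 𝕃)).IsRoot y := by
    rw [WeierstrassCurve.Affine.equation_iff, e₁, e₂, e₃, e₄, e₆] at he
    rw [IsRoot.def, eval_map]
    simp only [q, eval₂_add, eval₂_neg, eval₂_mul, eval₂_C, eval₂_X, eval₂_pow, map_one, one_mul, map_neg,
      map_add, map_mul, map_pow, RingHom.coe_coe, hcoef]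
    linear_combination he
  obtain ⟨b, rfl⟩ := mem_range_of_isRoot_map (ι : AlgebraicClosure K →+* 𝕃) hq0 hroot
  have h1 : (W.baseChange 𝕃).toAffine.Nonsingular (ι a) (ι b) := by
    rw [← WeierstrassCurve.baseChange_baseChange_adicCompletion]; exact h
  have h₀ : (W.baseChange (AlgebraicClosure K)).toAffine.Nonsingular a b :=
    (WeierstrassCurve.Affine.baseChange_nonsingular (W := W) (f := ι) ι.injective a b).mp h1
  exact ⟨.some a b h₀, by rw [AddMonoidHom.coe_comp, Function.comp_apply]; exact emb_some W ι h₀⟩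

include hn hζ in
/-- **Galois descent to the layer**: a point of `X(K̄_v)` fixed by every `σ ∈ Γ_{K_v}` with
`σ ζ = ζ` has coordinates in `K_n = K_v(ζ)` (`mem_adjoin_of_forall_smul_eq`), i.e. lies in
`E(K_n)`. [folklore] -/
theorem mem_range_of_forall_map_eq {Q : (V[W]).toAffine.Point}
    (hQ : ∀ σ : absoluteGaloisGroup (v.adicCompletion K), σ • ζ = ζ →
      WeierstrassCurve.Affine.Point.map ((absoluteGaloisGroup.toAlgEquiv _ σ : 𝕃 ≃ₐ[𝕂] 𝕃) :
        𝕃 →ₐ[𝕂] 𝕃) Q = Q) : Q ∈ Rg[W] := by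
  have _ := hn; have _ := hζ
  rcases Q with _ | ⟨x, y, h⟩
  · exact ⟨0, by rw [map_zero]; rfl⟩
  · have hx : x ∈ IntermediateField.adjoin 𝕂 {ζ} := mem_adjoin_of_forall_smul_eq fun σ hσ ↦ by
      have := hQ σ hσ
      rw [WeierstrassCurve.Affine.Point.map_some, WeierstrassCurve.Affine.Point.some.injEq] at this
      exact this.1
    have hy : y ∈ IntermediateField.adjoin 𝕂 {ζ} := mem_adjoin_of_forall_smul_eq fun σ hσ ↦ by
      have := hQ σ hσ
      rw [WeierstrassCurve.Affine.Point.map_some, WeierstrassCurve.Affine.Point.some.injEq] at this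
      exact this.2
    have h' : ((W.baseChange 𝕂).baseChange (IntermediateField.adjoin 𝕂 {ζ})).toAffine.Nonsingular
        ⟨x, hx⟩ ⟨y, hy⟩ :=
      (WeierstrassCurve.Affine.baseChange_nonsingular (W := W.baseChange 𝕂)
        (f := IntermediateField.val (IntermediateField.adjoin 𝕂 {ζ})) Subtype.val_injective
        ⟨x, hx⟩ ⟨y, hy⟩).mp h
    exact ⟨.some ⟨x, hx⟩ ⟨y, hy⟩ h', by rw [WeierstrassCurve.Affine.Point.map_some]; rfl⟩

include hn hζ in
/-- An algebraic layer point is fixed by `σ|_{K̄}` for every `σ ∈ Γ_{K_v}` fixing `ζ`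
(`ι_*` is injective and equivariant). [folklore] -/
theorem smul_eq_self_of_mem_range {P : W.geomPoints} (hP : ι⁎[W] P ∈ Rg[W])
    {σ : absoluteGaloisGroup (v.adicCompletion K)} (hσ : σ • ζ = ζ) : resGalOfEmb ι σ • P = P := by
  have h1 := map_eq_self_of_smul_eq_of_mem_range hn hζ (W.baseChange 𝕂) hP hσ
  rw [← emb_smul] at h1
  exact emb_injective W ι h1

include hn hζ in
/-- **`φ` maps algebraic layer points to algebraic layer points.** If `ι_* P ∈ E(K_n)` then
`ι_* (φ P) ∈ E'(K_n)`: for `σ ∈ Γ_{K_v}` fixing `ζ`, `σ|_{K̄}` fixes `P`, hence `φ P` (`φ` is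
`Γ_K`-equivariant); Galois descent. [cite: SilvermanAEC2009, III.4 (isogenies defined over `K`) and VIII.§1] -/
theorem emb_isogeny_mem_range (φ : WeierstrassCurve.Isogeny W W') {P : W.geomPoints}
    (hP : ι⁎[W] P ∈ Rg[W]) : ι⁎[W'] (φ P) ∈ Rg[W'] := by
  refine mem_range_of_forall_map_eq hn hζ W' fun σ hσ ↦ ?_
  rw [← emb_smul, ← WeierstrassCurve.Isogeny.map_smul, smul_eq_self_of_mem_range hn hζ W ι hP hσ]

include hw in
/-- A `Γ_{K_v}`-conjugate of a point of `E₁` lies in `E₁`, with the same `|z|` (`|σ a|_v = |a|_v`).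
[folklore] -/
theorem map_gal_mem_kernel {Y : WeierstrassCurve K} [(V[Y]).IsIntegral w.integer]
    (σ : absoluteGaloisGroup (v.adicCompletion K)) {P : (V[Y]).toAffine.Point}
    (hP : P ∈ kernel w (V[Y])) :
    WeierstrassCurve.Affine.Point.map ((absoluteGaloisGroup.toAlgEquiv _ σ : 𝕃 ≃ₐ[𝕂] 𝕃) :
        𝕃 →ₐ[𝕂] 𝕃) P ∈ kernel w (V[Y]) ∧
      w (WeierstrassCurve.Affine.Point.map ((absoluteGaloisGroup.toAlgEquiv _ σ : 𝕃 ≃ₐ[𝕂] 𝕃) :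
        𝕃 →ₐ[𝕂] 𝕃) P).zCoord = w P.zCoord := by
  rcases P with _ | ⟨x, y, h⟩
  · rw [← WeierstrassCurve.Affine.Point.zero_def, map_zero]
    exact ⟨no_implicit_lambda% (AddSubgroup.zero_mem _), rfl⟩
  · rw [WeierstrassCurve.Affine.Point.map_some, WeierstrassCurve.Affine.Point.zCoord_some,
      WeierstrassCurve.Affine.Point.zCoord_some]
    have hx : 1 < w x := (some_mem_kernel_iff _).mp hP
    refine ⟨some_mem_kernel _ ?_, ?_⟩
    · change 1 < w (σ • x)
      rwa [spectralValuation_smul hw]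
    · rw [← map_neg, ← map_div₀]
      exact spectralValuation_smul hw σ (-x / y)

/-! ## Level shift by the multiplier -/

/-- **Level shift.** Let `φ : W → W'` have `x`-coordinate `A(x)/B(x)` off the finite set `Bad`,
`B` monic, `deg A = deg B + 1`, `lc A = c⁻²`. There is `t₀ > 0` such that every algebraic point
`P` of `E₁ ⊆ X(K̄_v)` of level `< t₀` is `O` or outside `Bad`, and `φ P` lies in `E₁'` with
**`|z(φ P)|_v = |c|_v · |z(P)|_v`**: for `|x|` large `|A(x)/B(x)| = |c|⁻²·|x|`
(`exists_val_eval_eq`), and `|x|·|z|² = 1` on `E₁` (`val_X_mul_val_zCoord_sq`). This is the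
elementary shadow of `φ^* ω' = c·ω` on the formal groups. [cite: SilvermanAEC2009, IV.3–IV.4 and Prop. VII.2.2] -/
theorem exists_level_shift [(V[W]).IsIntegral w.integer] [(V[W']).IsIntegral w.integer]
    (φ : WeierstrassCurve.Isogeny W W') {A B : K[X]} {Bad : Set W.geomPoints} {c : K} (hc : c ≠ 0)
    (hBad : Bad.Finite) (hBm : B.Monic) (hdeg : A.natDegree = B.natDegree + 1)
    (hlc : A.leadingCoeff = c⁻¹ ^ 2)
    (hφ : ∀ (x y : AlgebraicClosure K)
      (h : (W.baseChange (AlgebraicClosure K)).toAffine.Nonsingular x y),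
      (.some x y h : W.geomPoints) ∉ Bad → aeval x B ≠ 0 ∧ ∃ (y₂ : AlgebraicClosure K)
        (h₂ : (W'.baseChange (AlgebraicClosure K)).toAffine.Nonsingular (aeval x A / aeval x B) y₂),
        φ (.some x y h) = .some (aeval x A / aeval x B) y₂ h₂) :
    ∃ t₀ : ℝ≥0, 0 < t₀ ∧ ∀ P : W.geomPoints, ι⁎[W] P ∈ kernel w (V[W]) →
      w (ι⁎[W] P).zCoord < t₀ →
      (P = 0 ∨ P ∉ Bad) ∧ ι⁎[W'] (φ P) ∈ kernel w (V[W']) ∧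
        w (ι⁎[W'] (φ P)).zCoord = w (algebraMap K 𝕃 c) * w (ι⁎[W] P).zCoord := by
  have hfc0 : algebraMap K 𝕃 c ≠ 0 := (map_ne_zero (algebraMap K 𝕃)).mpr hc
  have hcv : 0 < w (algebraMap K 𝕃 c) := pos_iff_ne_zero.mpr ((Valuation.ne_zero_iff w).mpr hfc0)
  have hA0 : A ≠ 0 := fun h ↦ by
    rw [h, leadingCoeff_zero] at hlc; exact pow_ne_zero 2 (inv_ne_zero hc) hlc.symm
  obtain ⟨MA, hMA⟩ := exists_val_eval_eq w (p := A.map (algebraMap K 𝕃)) (Polynomial.map_ne_zero hA0)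
  obtain ⟨MB, hMB⟩ := exists_val_eval_eq w (p := B.map (algebraMap K 𝕃)) (Polynomial.map_ne_zero hBm.ne_zero)
  obtain ⟨tb, htb0, htb⟩ :=
    exists_pos_lt_of_finite (hBad.image fun b : W.geomPoints ↦ w (ι⁎[W] b).zCoord)
  set M : ℝ≥0 := max (max MA MB) (max 1 (w (algebraMap K 𝕃 c) ^ 2)) with hM
  have hM1 : 0 < M + 1 := add_pos_of_nonneg_of_pos zero_le one_pos
  refine ⟨min tb (M + 1)⁻¹, lt_min htb0 (inv_pos.mpr hM1), fun P hP1 hPz ↦ ?_⟩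
  have hιcoe : ∀ a : AlgebraicClosure K, ι a = (ι : AlgebraicClosure K →+* 𝕃) a := fun _ ↦ rfl
  by_cases hP0 : P = 0
  · subst hP0
    refine ⟨Or.inl rfl, ?_, ?_⟩
    · rw [map_zero φ, map_zero (ι⁎[W'])]; exact no_implicit_lambda% (AddSubgroup.zero_mem _)
    · simp only [map_zero φ, map_zero (ι⁎[W']), map_zero (ι⁎[W]),
        WeierstrassCurve.Affine.Point.zCoord_zero, map_zero w, mul_zero]
  obtain ⟨x, y, h, rfl⟩ : ∃ x y h, P = .some x y h := by
    rcases P with _ | ⟨x, y, h⟩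
    · exact (hP0 rfl).elim
    · exact ⟨x, y, h, rfl⟩
  rw [emb_some] at hP1 hPz ⊢
  rw [WeierstrassCurve.Affine.Point.zCoord_some] at hPz ⊢
  have hx1 : 1 < w (ι x) := (some_mem_kernel_iff _).mp hP1
  obtain ⟨hxz, -, hy0⟩ := val_X_mul_val_zCoord_sq hP1
  have hz0 : 0 < w (-ι x / ι y) := by
    rw [pos_iff_ne_zero, Valuation.ne_zero_iff, div_ne_zero_iff, neg_ne_zero]
    exact ⟨fun h0 ↦ by rw [h0, map_zero] at hx1; exact not_lt_zero hx1, hy0⟩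
  have hz1 : w (-ι x / ι y) < 1 := by
    have := val_zCoord_lt_one hP1
    rwa [WeierstrassCurve.Affine.Point.zCoord_some] at this
  -- `|x| > M`
  have hxM : M < w (ι x) := by
    have hz2 : w (-ι x / ι y) ^ 2 < (M + 1)⁻¹ :=
      (pow_le_of_le_one zero_le hz1.le two_ne_zero).trans_lt (lt_of_lt_of_le hPz (min_le_right _ _))
    have hx : w (ι x) = (w (-ι x / ι y) ^ 2)⁻¹ := eq_inv_of_mul_eq_one_left hxz
    rw [hx]
    exact (lt_add_one M).trans ((lt_inv_comm₀ (pow_pos hz0 2) hM1).mp hz2)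
  have hxA : MA < w (ι x) := lt_of_le_of_lt ((le_max_left _ _).trans (le_max_left _ _)) hxM
  have hxB : MB < w (ι x) := lt_of_le_of_lt ((le_max_right _ _).trans (le_max_left _ _)) hxM
  have hxc : w (algebraMap K 𝕃 c) ^ 2 < w (ι x) := lt_of_le_of_lt ((le_max_right _ _).trans (le_max_right _ _)) hxM
  -- not a bad point
  have hnot : (.some x y h : W.geomPoints) ∉ Bad := fun hb ↦ by
    have := htb (w (ι⁎[W] (.some x y h)).zCoord) ⟨.some x y h, hb, rfl⟩
    rw [emb_some, WeierstrassCurve.Affine.Point.zCoord_some] at this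
    exact (lt_irrefl _) ((this hz0.ne').trans (lt_of_lt_of_le hPz (min_le_left _ _)))
  refine ⟨Or.inr hnot, ?_⟩
  obtain ⟨hB0, y₂, h₂, hφP⟩ := hφ x y h hnot
  -- `|A(x)| = |c|⁻² |x|^{e+1}`, `|B(x)| = |x|^e`
  have hevA : w (ι (aeval x A)) = (w (algebraMap K 𝕃 c))⁻¹ ^ 2 * w (ι x) ^ (B.natDegree + 1) := by
    rw [← aeval_algHom_apply, ← eval_map_algebraMap, hMA _ hxA, leadingCoeff_map, natDegree_map,
      hlc, hdeg, map_pow, map_inv₀, map_pow, map_inv₀]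
  have hevB : w (ι (aeval x B)) = w (ι x) ^ B.natDegree := by
    rw [← aeval_algHom_apply, ← eval_map_algebraMap, hMB _ hxB, leadingCoeff_map, natDegree_map,
      hBm.leadingCoeff, map_one, map_one, one_mul]
  have hx0 : 0 < w (ι x) := zero_lt_one.trans hx1
  have hx₂ : w (ι (aeval x A / aeval x B)) = (w (algebraMap K 𝕃 c))⁻¹ ^ 2 * w (ι x) := by
    rw [map_div₀, map_div₀, hevA, hevB, pow_succ (w (ι x)) B.natDegree,
      mul_comm (w (ι x) ^ B.natDegree) (w (ι x)), ← mul_assoc, mul_div_assoc,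
      div_self (pow_pos hx0 _).ne', mul_one]
  have hx₂1 : 1 < w (ι (aeval x A / aeval x B)) := by
    rw [hx₂]
    calc (1 : ℝ≥0) = (w (algebraMap K 𝕃 c))⁻¹ ^ 2 * w (algebraMap K 𝕃 c) ^ 2 := by
          rw [inv_pow, inv_mul_cancel₀ (pow_pos hcv 2).ne']
      _ < (w (algebraMap K 𝕃 c))⁻¹ ^ 2 * w (ι x) := mul_lt_mul_of_pos_left hxc (pow_pos (inv_pos.mpr hcv) 2)
  rw [hφP, emb_some]
  have hP'1 : (.some (ι (aeval x A / aeval x B)) (ι y₂) (nonsingular_emb W' ι h₂) :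
      (V[W']).toAffine.Point) ∈ kernel w (V[W']) := some_mem_kernel _ hx₂1
  refine ⟨hP'1, ?_⟩
  obtain ⟨hxz', -, -⟩ := val_X_mul_val_zCoord_sq hP'1
  rw [WeierstrassCurve.Affine.Point.zCoord_some]
  -- compare squares
  have hsq : w (-ι (aeval x A / aeval x B) / ι y₂) ^ 2 = (w (algebraMap K 𝕃 c) * w (-ι x / ι y)) ^ 2 := by
    have e1 : w (-ι (aeval x A / aeval x B) / ι y₂) ^ 2 = (w (ι (aeval x A / aeval x B)))⁻¹ :=
      eq_inv_of_mul_eq_one_right hxz'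
    have e2 : w (-ι x / ι y) ^ 2 = (w (ι x))⁻¹ := eq_inv_of_mul_eq_one_right hxz
    rw [e1, mul_pow, e2, hx₂, mul_inv, inv_pow, inv_inv]
  exact (pow_left_inj₀ zero_le zero_le two_ne_zero).mp hsq

/-! ## Surjectivity onto deep levels, with descent to the layer -/

include hw hn hζ in
/-- **Deep points of `φ(E(K̄))` have deep LAYER preimages.** With `φ, A, B, Bad, c` as in
`exists_level_shift` and `W` elliptic, there is `t₁ > 0` such that: if `P₀` is an algebraic layer
point of `W` and `φ P₀` lies in `E₁'` with `|z(φ P₀)| < t₁`, then `φ P₀ = φ P₁` for an algebraic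
layer point `P₁ ∈ E₁` with `|c|·|z(P₁)| = |z(φ P₀)|`. Construction: `x(P₁)` is the root of
size `|x(φP₀)|·|c|²` of `A - x(φP₀)·B ∈ K̄[X]` (`exists_isRoot_val_eq`), so `x(φ P₁) = x(φ P₀)`
and `φ P₁ = ± φ P₀` (fix the sign); `P₁` is a layer point by Galois descent: for `σ ∈ Γ_{K_v}`
fixing `ζ`, `σ|_{K̄} P₁ - P₁ ∈ ker φ` has level `≤ |z(P₁)|`, below every nonzero element of the
finite group `ker φ`, hence vanishes. (This replaces the Néron mapping property.)
[cite: SilvermanAEC2009, III.4, IV.3 and Prop. VII.2.2] -/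
theorem exists_deep_preimage [(V[W]).IsIntegral w.integer] [(V[W']).IsIntegral w.integer]
    [W.IsElliptic] (φ : WeierstrassCurve.Isogeny W W') {A B : K[X]} {Bad : Set W.geomPoints}
    {c : K} (hc : c ≠ 0) (hBad : Bad.Finite) (hBm : B.Monic) (hdeg : A.natDegree = B.natDegree + 1)
    (hlc : A.leadingCoeff = c⁻¹ ^ 2)
    (hφ : ∀ (x y : AlgebraicClosure K)
      (h : (W.baseChange (AlgebraicClosure K)).toAffine.Nonsingular x y),
      (.some x y h : W.geomPoints) ∉ Bad → aeval x B ≠ 0 ∧ ∃ (y₂ : AlgebraicClosure K)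
        (h₂ : (W'.baseChange (AlgebraicClosure K)).toAffine.Nonsingular (aeval x A / aeval x B) y₂),
        φ (.some x y h) = .some (aeval x A / aeval x B) y₂ h₂) :
    ∃ t₁ : ℝ≥0, 0 < t₁ ∧ ∀ P₀ : W.geomPoints, ι⁎[W] P₀ ∈ Rg[W] →
      ι⁎[W'] (φ P₀) ∈ kernel w (V[W']) → w (ι⁎[W'] (φ P₀)).zCoord < t₁ →
      ∃ P₁ : W.geomPoints, ι⁎[W] P₁ ∈ Rg[W] ∧ ι⁎[W] P₁ ∈ kernel w (V[W]) ∧ φ P₁ = φ P₀ ∧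
        w (algebraMap K 𝕃 c) * w (ι⁎[W] P₁).zCoord = w (ι⁎[W'] (φ P₀)).zCoord := by
  have hfc0 : algebraMap K 𝕃 c ≠ 0 := (map_ne_zero (algebraMap K 𝕃)).mpr hc
  have hcv : 0 < w (algebraMap K 𝕃 c) := pos_iff_ne_zero.mpr ((Valuation.ne_zero_iff w).mpr hfc0)
  obtain ⟨t₀, ht₀, hshift⟩ := exists_level_shift (w := w) W W' ι φ hc hBad hBm hdeg hlc hφ
  obtain ⟨tk, htk0, htk⟩ := exists_pos_lt_of_finite
    (φ.finite_ker.image fun k : W.geomPoints ↦ w (ι⁎[W] k).zCoord)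
  -- the valuation `w ∘ ι` on `K̄`
  let w' : Valuation (AlgebraicClosure K) ℝ≥0 := w.comap (ι : AlgebraicClosure K →+* 𝕃)
  have hw' : ∀ a, w' a = w (ι a) := fun _ ↦ rfl
  have hιf : ∀ b : K, ι (algebraMap K (AlgebraicClosure K) b) = algebraMap K 𝕃 b :=
    fun b ↦ ι.commutes b
  -- a bound for the coefficients
  let CAB : ℝ≥0 := (Finset.range (B.natDegree + 1)).sup
    (fun i ↦ max (w (algebraMap K 𝕃 (A.coeff i))) (w (algebraMap K 𝕃 (B.coeff i)))) + 1
  have hCA : ∀ i, i < B.natDegree + 1 → w (algebraMap K 𝕃 (A.coeff i)) < CAB := fun i hi ↦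
    lt_of_le_of_lt ((le_max_left _ _).trans (Finset.le_sup (f := fun i ↦
      max (w (algebraMap K 𝕃 (A.coeff i))) (w (algebraMap K 𝕃 (B.coeff i)))) (Finset.mem_range.mpr hi)))
      (lt_add_one _)
  have hCB : ∀ i, i < B.natDegree + 1 → w (algebraMap K 𝕃 (B.coeff i)) < CAB := fun i hi ↦
    lt_of_le_of_lt ((le_max_right _ _).trans (Finset.le_sup (f := fun i ↦
      max (w (algebraMap K 𝕃 (A.coeff i))) (w (algebraMap K 𝕃 (B.coeff i)))) (Finset.mem_range.mpr hi)))
      (lt_add_one _)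
  have hCAB1 : 1 ≤ CAB := le_add_self
  -- threshold: `|x_Q|` must exceed `Mx`
  set Mx : ℝ≥0 := CAB * (w (algebraMap K 𝕃 c))⁻¹ ^ 2 + CAB with hMx
  have hMx1 : 0 < Mx + 1 := add_pos_of_nonneg_of_pos zero_le one_pos
  refine ⟨min (w (algebraMap K 𝕃 c) * min t₀ tk) (Mx + 1)⁻¹,
    lt_min (mul_pos hcv (lt_min ht₀ htk0)) (inv_pos.mpr hMx1), fun P₀ hP₀ hQ1 hQz ↦ ?_⟩
  -- name the target point `Q = φ P₀`
  -- Galois descent for a preimage of `Q` in `E₁` of level `< tk`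
  have descent : ∀ P₁ : W.geomPoints, φ P₁ = φ P₀ → ι⁎[W] P₁ ∈ kernel w (V[W]) →
      w (ι⁎[W] P₁).zCoord < tk → ι⁎[W] P₁ ∈ Rg[W] := by
    intro P₁ hP₁φ hP₁1 hP₁z
    refine mem_range_of_forall_map_eq hn hζ W fun σ hσ ↦ ?_
    have hτP₀ : resGalOfEmb ι σ • P₀ = P₀ := smul_eq_self_of_mem_range hn hζ W ι hP₀ hσ
    set k : W.geomPoints := resGalOfEmb ι σ • P₁ - P₁ with hk_def
    have hk : k ∈ φ.toAddMonoidHom.ker := by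
      rw [AddMonoidHom.mem_ker, WeierstrassCurve.Isogeny.coe_toAddMonoidHom, hk_def, map_sub,
        WeierstrassCurve.Isogeny.map_smul, hP₁φ, ← WeierstrassCurve.Isogeny.map_smul,
        hτP₀, sub_self]
    have hgal := map_gal_mem_kernel hw (Y := W) σ hP₁1
    have hιk : ι⁎[W] k = WeierstrassCurve.Affine.Point.map
        ((absoluteGaloisGroup.toAlgEquiv _ σ : 𝕃 ≃ₐ[𝕂] 𝕃) : 𝕃 →ₐ[𝕂] 𝕃) (ι⁎[W] P₁) - ι⁎[W] P₁ := by
      rw [hk_def, map_sub, emb_smul]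
    have hk1 : ι⁎[W] k ∈ kernel w (V[W]) := by rw [hιk]; exact (kernel w (V[W])).sub_mem hgal.1 hP₁1
    have hkz : w (ι⁎[W] k).zCoord ≤ w (ι⁎[W] P₁).zCoord := by
      rw [hιk, ← val_zCoord_sub hgal.1 hP₁1]
      refine (Valuation.map_sub w _ _).trans ?_
      rw [hgal.2, max_self]
    have hk0 : k = 0 := by
      by_contra hne
      have hιk0 : ι⁎[W] k ≠ 0 := fun h0 ↦ hne (emb_injective W ι (by rw [h0, map_zero]))
      have hz0 : (ι⁎[W] k).zCoord ≠ 0 := fun h0 ↦ hιk0 ((zCoord_eq_zero_iff hk1).mp h0)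
      have := htk (w (ι⁎[W] k).zCoord) ⟨k, hk, rfl⟩ ((Valuation.ne_zero_iff w).mpr hz0)
      exact lt_irrefl _ ((this.trans_le hkz).trans hP₁z)
    rw [hk_def, sub_eq_zero] at hk0
    rw [← emb_smul, hk0]
  by_cases hQ0 : φ P₀ = 0
  · -- `φ P₀ = O`: take `P₁ = O`
    refine ⟨0, by rw [map_zero]; exact zero_mem _, by rw [map_zero]; exact
      no_implicit_lambda% (AddSubgroup.zero_mem _), by rw [map_zero φ, hQ0], ?_⟩
    rw [hQ0]
    simp only [map_zero (ι⁎[W]), map_zero (ι⁎[W']), WeierstrassCurve.Affine.Point.zCoord_zero,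
      map_zero w, mul_zero]
  obtain ⟨xQ, yQ, hQ, hQ_def⟩ : ∃ xQ yQ hQ, φ P₀ = .some xQ yQ hQ := by
    generalize φ P₀ = Q at hQ0 ⊢
    rcases Q with _ | ⟨xQ, yQ, hQ⟩
    · exact (hQ0 rfl).elim
    · exact ⟨xQ, yQ, hQ, rfl⟩
  rw [hQ_def] at hQ1 hQz
  rw [emb_some] at hQ1 hQz
  rw [WeierstrassCurve.Affine.Point.zCoord_some] at hQz
  have hxQ1 : 1 < w (ι xQ) := (some_mem_kernel_iff _).mp hQ1
  have hxQ0 : 0 < w (ι xQ) := zero_lt_one.trans hxQ1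
  obtain ⟨hxzQ, -, hyQ0⟩ := val_X_mul_val_zCoord_sq hQ1
  have hzQ0 : 0 < w (-ι xQ / ι yQ) := by
    rw [pos_iff_ne_zero, Valuation.ne_zero_iff, div_ne_zero_iff, neg_ne_zero]
    exact ⟨fun h0 ↦ by rw [h0, map_zero] at hxQ1; exact not_lt_zero hxQ1, hyQ0⟩
  have hzQ1 : w (-ι xQ / ι yQ) < 1 := by
    have := val_zCoord_lt_one hQ1
    rwa [WeierstrassCurve.Affine.Point.zCoord_some] at this
  -- `|x_Q| > Mx`
  have hxMx : Mx < w (ι xQ) := by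
    have hz2 : w (-ι xQ / ι yQ) ^ 2 < (Mx + 1)⁻¹ :=
      (pow_le_of_le_one zero_le hzQ1.le two_ne_zero).trans_lt (lt_of_lt_of_le hQz (min_le_right _ _))
    have hx : w (ι xQ) = (w (-ι xQ / ι yQ) ^ 2)⁻¹ := eq_inv_of_mul_eq_one_left hxzQ
    rw [hx]
    exact (lt_add_one Mx).trans ((lt_inv_comm₀ (pow_pos hzQ0 2) hMx1).mp hz2)
  have hxCAB : CAB < w (ι xQ) := lt_of_le_of_lt (by rw [hMx]; exact le_add_self) hxMx
  -- the polynomial `G = A' - x_Q B'` over `K̄` and its root of size `R = |x_Q| |c|²`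
  set R : ℝ≥0 := w (ι xQ) * w (algebraMap K 𝕃 c) ^ 2 with hR_def
  have hR0 : 0 < R := mul_pos hxQ0 (pow_pos hcv 2)
  have hRCAB : CAB < R := by
    calc CAB = CAB * (w (algebraMap K 𝕃 c))⁻¹ ^ 2 * w (algebraMap K 𝕃 c) ^ 2 := by
          rw [mul_assoc, inv_pow, inv_mul_cancel₀ (pow_pos hcv 2).ne', mul_one]
      _ ≤ Mx * w (algebraMap K 𝕃 c) ^ 2 := by rw [hMx]; gcongr; exact le_self_add
      _ < w (ι xQ) * w (algebraMap K 𝕃 c) ^ 2 := mul_lt_mul_of_pos_right hxMx (pow_pos hcv 2)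
  have hR1 : 1 < R := lt_of_le_of_lt hCAB1 hRCAB
  have hxQne : xQ ≠ 0 := fun h0 ↦ by rw [h0, map_zero, map_zero] at hxQ1; exact not_lt_zero hxQ1
  have hA'deg : (A.map (algebraMap K (AlgebraicClosure K))).natDegree = B.natDegree + 1 := by
    rw [natDegree_map, hdeg]
  have hB'deg : (B.map (algebraMap K (AlgebraicClosure K))).natDegree = B.natDegree := natDegree_map _
  have hB'm : (B.map (algebraMap K (AlgebraicClosure K))).Monic := hBm.map _
  have hCdeg : (C xQ * B.map (algebraMap K (AlgebraicClosure K))).natDegree <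
      (A.map (algebraMap K (AlgebraicClosure K))).natDegree := by
    rw [natDegree_C_mul hxQne, hB'deg, hA'deg]; exact Nat.lt_succ_self _
  have hGdeg : (A.map (algebraMap K (AlgebraicClosure K)) -
      C xQ * B.map (algebraMap K (AlgebraicClosure K))).natDegree = B.natDegree + 1 := by
    rw [natDegree_sub_eq_left_of_natDegree_lt hCdeg, hA'deg]
  have hGlc : (A.map (algebraMap K (AlgebraicClosure K)) -
      C xQ * B.map (algebraMap K (AlgebraicClosure K))).leadingCoeff =
        algebraMap K (AlgebraicClosure K) (c⁻¹ ^ 2) := by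
    rw [leadingCoeff_sub_of_degree_lt (degree_lt_degree hCdeg), leadingCoeff_map, hlc]
  have hGe : (A.map (algebraMap K (AlgebraicClosure K)) -
      C xQ * B.map (algebraMap K (AlgebraicClosure K))).coeff B.natDegree =
        algebraMap K (AlgebraicClosure K) (A.coeff B.natDegree) - xQ := by
    rw [coeff_sub, coeff_C_mul, ← hB'deg, hB'm.coeff_natDegree, mul_one, hB'deg, coeff_map]
  have hGi : ∀ i, (A.map (algebraMap K (AlgebraicClosure K)) -
      C xQ * B.map (algebraMap K (AlgebraicClosure K))).coeff i =
        algebraMap K (AlgebraicClosure K) (A.coeff i) - xQ * algebraMap K (AlgebraicClosure K) (B.coeff i) :=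
    fun i ↦ by rw [coeff_sub, coeff_C_mul, coeff_map, coeff_map]
  have hwe : w' ((A.map (algebraMap K (AlgebraicClosure K)) -
      C xQ * B.map (algebraMap K (AlgebraicClosure K))).coeff B.natDegree) = w (ι xQ) := by
    rw [hw', hGe, map_sub, sub_eq_add_neg, Valuation.map_add_eq_of_lt_right]
    · exact Valuation.map_neg w _
    · rw [Valuation.map_neg, hιf]
      exact (hCA _ (Nat.lt_succ_self _)).trans hxCAB
  have htop : w' (A.map (algebraMap K (AlgebraicClosure K)) -
      C xQ * B.map (algebraMap K (AlgebraicClosure K))).leadingCoeff * R =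
      w' ((A.map (algebraMap K (AlgebraicClosure K)) -
        C xQ * B.map (algebraMap K (AlgebraicClosure K))).coeff B.natDegree) := by
    rw [hwe, hw', hGlc, hιf, map_pow, map_inv₀, map_pow, map_inv₀, hR_def, inv_pow,
      mul_comm ((w (algebraMap K 𝕃 c) ^ 2)⁻¹) _, mul_assoc, mul_inv_cancel₀ (pow_pos hcv 2).ne', mul_one]
  have hlow : ∀ i < B.natDegree, w' ((A.map (algebraMap K (AlgebraicClosure K)) -
      C xQ * B.map (algebraMap K (AlgebraicClosure K))).coeff i) * R ^ i <
      w' ((A.map (algebraMap K (AlgebraicClosure K)) -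
        C xQ * B.map (algebraMap K (AlgebraicClosure K))).coeff B.natDegree) * R ^ B.natDegree := by
    intro i hi
    have hci : w' ((A.map (algebraMap K (AlgebraicClosure K)) -
        C xQ * B.map (algebraMap K (AlgebraicClosure K))).coeff i) < CAB * w (ι xQ) := by
      rw [hw', hGi, map_sub, map_mul, hιf, hιf]
      refine lt_of_le_of_lt (Valuation.map_sub w _ _) (max_lt ?_ ?_)
      · calc w (algebraMap K 𝕃 (A.coeff i)) < CAB := hCA i (Nat.lt_succ_of_lt hi)
          _ = CAB * 1 := (mul_one _).symm
          _ ≤ CAB * w (ι xQ) := mul_le_mul_of_nonneg_left hxQ1.le zero_le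
      · rw [map_mul, mul_comm]
        exact mul_lt_mul_of_pos_right (hCB i (Nat.lt_succ_of_lt hi)) hxQ0
    obtain ⟨d, hd⟩ : ∃ d, B.natDegree = i + (d + 1) := ⟨B.natDegree - i - 1, by omega⟩
    rw [hwe]
    calc w' ((A.map (algebraMap K (AlgebraicClosure K)) -
          C xQ * B.map (algebraMap K (AlgebraicClosure K))).coeff i) * R ^ i
          < CAB * w (ι xQ) * R ^ i := mul_lt_mul_of_pos_right hci (pow_pos hR0 i)
      _ ≤ R ^ (d + 1) * w (ι xQ) * R ^ i := by
          gcongr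
          exact hRCAB.le.trans (le_self_pow₀ hR1.le (Nat.succ_ne_zero d))
      _ = w (ι xQ) * R ^ B.natDegree := by rw [hd, pow_add]; ring
  obtain ⟨X₁, hGX₁, hX₁R⟩ := exists_isRoot_val_eq w' hGdeg hR0 htop hlow
  rw [hw'] at hX₁R
  have hX₁1 : 1 < w (ι X₁) := by rw [hX₁R]; exact hR1
  obtain ⟨Y₁, hXY⟩ := WeierstrassCurve.exists_equation (W.baseChange (AlgebraicClosure K)) X₁
  have h₁ : (W.baseChange (AlgebraicClosure K)).toAffine.Nonsingular X₁ Y₁ :=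
    WeierstrassCurve.Affine.equation_iff_nonsingular.mp hXY
  -- a preimage of `Q` in `E₁` of the right level (fix the sign)
  have hpre : ∃ P₁ : W.geomPoints, φ P₁ = .some xQ yQ hQ ∧ ι⁎[W] P₁ ∈ kernel w (V[W]) ∧
      w (ι⁎[W] P₁).zCoord = w (-ι xQ / ι yQ) / w (algebraMap K 𝕃 c) := by
    have hP'1 : ι⁎[W] (.some X₁ Y₁ h₁) ∈ kernel w (V[W]) := by
      rw [emb_some]; exact some_mem_kernel _ hX₁1
    have hP'z : w (ι⁎[W] (.some X₁ Y₁ h₁)).zCoord = w (-ι xQ / ι yQ) / w (algebraMap K 𝕃 c) := by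
      rw [emb_some, WeierstrassCurve.Affine.Point.zCoord_some]
      have hk := (val_X_mul_val_zCoord_sq (some_mem_kernel (nonsingular_emb W ι h₁) hX₁1)).1
      have e1 : w (-ι X₁ / ι Y₁) ^ 2 = (w (ι X₁))⁻¹ := eq_inv_of_mul_eq_one_right hk
      have e2 : w (-ι xQ / ι yQ) ^ 2 = (w (ι xQ))⁻¹ := eq_inv_of_mul_eq_one_right hxzQ
      have hsq : w (-ι X₁ / ι Y₁) ^ 2 = (w (-ι xQ / ι yQ) / w (algebraMap K 𝕃 c)) ^ 2 := by
        rw [e1, div_pow, e2, hX₁R, hR_def, mul_inv, div_eq_mul_inv]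
      exact (pow_left_inj₀ zero_le zero_le two_ne_zero).mp hsq
    have hP'zt : w (ι⁎[W] (.some X₁ Y₁ h₁)).zCoord < min t₀ tk := by
      rw [hP'z, div_lt_iff₀ hcv, mul_comm]
      exact lt_of_lt_of_le hQz (min_le_left _ _)
    have hnb : (.some X₁ Y₁ h₁ : W.geomPoints) ∉ Bad := by
      rcases (hshift _ hP'1 (hP'zt.trans_le (min_le_left _ _))).1 with h0 | h
      · exact (WeierstrassCurve.Affine.Point.some_ne_zero _ h0).elim
      · exact h
    obtain ⟨hB0, y₂, h₂, hφ₁⟩ := hφ X₁ Y₁ h₁ hnb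
    have hAB : aeval X₁ A / aeval X₁ B = xQ := by
      have h0 : aeval X₁ A - xQ * aeval X₁ B = 0 := by
        have := hGX₁
        rwa [IsRoot.def, eval_sub, eval_mul, eval_C, eval_map_algebraMap, eval_map_algebraMap] at this
      rw [div_eq_iff hB0]; exact sub_eq_zero.mp h0
    subst hAB
    rcases WeierstrassCurve.Affine.Y_eq_of_X_eq h₂.1 hQ.1 rfl with hy | hy
    · subst hy
      exact ⟨.some X₁ Y₁ h₁, hφ₁, hP'1, hP'z⟩
    · refine ⟨-(.some X₁ Y₁ h₁), ?_, by rw [map_neg]; exact (kernel w (V[W])).neg_mem hP'1, by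
        rw [map_neg, val_zCoord_neg hP'1]; exact hP'z⟩
      rw [map_neg, hφ₁]
      refine (WeierstrassCurve.Affine.Point.neg_some h₂).trans ?_
      subst hy
      rw [WeierstrassCurve.Affine.Point.some.injEq]
      exact ⟨rfl, WeierstrassCurve.Affine.negY_negY _ _⟩
  obtain ⟨P₁, hP₁φ, hP₁1, hP₁z⟩ := hpre
  have hP₁zt : w (ι⁎[W] P₁).zCoord < min t₀ tk := by
    rw [hP₁z, div_lt_iff₀ hcv, mul_comm]
    exact lt_of_lt_of_le hQz (min_le_left _ _)
  refine ⟨P₁, descent P₁ (hP₁φ.trans hQ_def.symm) hP₁1 (hP₁zt.trans_le (min_le_right _ _)), hP₁1,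
    hP₁φ.trans hQ_def.symm, ?_⟩
  rw [hP₁z, hQ_def, emb_some, WeierstrassCurve.Affine.Point.zCoord_some, mul_div_cancel₀ _ hcv.ne']

/-! ## The counting inequality -/

include hw hn hζ in
/-- **The counting inequality.** With `φ, A, B, Bad, c` as above (`W` elliptic) there is
`t₁ > 0` such that for every `t < t₁` with `[E'(K_n) : E'⁽ᵗ⁾(K_n)]` finite: a finite family `S`
of algebraic layer points of `W`, pairwise inequivalent modulo the level `E⁽ᵗ/|c|⁾`, has
**`#S ≤ #ker φ · [E'(K_n) : E'⁽ᵗ⁾(K_n)]`**. Indeed `P ↦ ι_* φ P mod E'⁽ᵗ⁾(K_n)` has fibres of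
size `≤ #ker φ`: if `φ P ≡ φ P'`, a deep layer preimage `P₁` of `φ(P - P')`
(`exists_deep_preimage`) has level `t/|c|`, and `P - P' - P₁ ∈ ker φ` determines `P` given `P'`.
[cite: SilvermanAEC2009, III.4 and Prop. VII.2.2] -/
theorem card_le_degree_mul_relIndex [(V[W]).IsIntegral w.integer] [(V[W']).IsIntegral w.integer]
    [W.IsElliptic] (φ : WeierstrassCurve.Isogeny W W') {A B : K[X]} {Bad : Set W.geomPoints}
    {c : K} (hc : c ≠ 0) (hBad : Bad.Finite) (hBm : B.Monic) (hdeg : A.natDegree = B.natDegree + 1)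
    (hlc : A.leadingCoeff = c⁻¹ ^ 2)
    (hφ : ∀ (x y : AlgebraicClosure K)
      (h : (W.baseChange (AlgebraicClosure K)).toAffine.Nonsingular x y),
      (.some x y h : W.geomPoints) ∉ Bad → aeval x B ≠ 0 ∧ ∃ (y₂ : AlgebraicClosure K)
        (h₂ : (W'.baseChange (AlgebraicClosure K)).toAffine.Nonsingular (aeval x A / aeval x B) y₂),
        φ (.some x y h) = .some (aeval x A / aeval x B) y₂ h₂) :
    ∃ t₁ : ℝ≥0, 0 < t₁ ∧ ∀ {t : ℝ≥0}, t < t₁ →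
      (level w (V[W']) t ⊓ Rg[W']).relIndex Rg[W'] ≠ 0 →
      ∀ S : Finset W.geomPoints, (∀ P ∈ S, ι⁎[W] P ∈ Rg[W]) →
        (∀ P ∈ S, ∀ P' ∈ S, P ≠ P' →
          ι⁎[W] (P - P') ∉ level w (V[W]) (t / w (algebraMap K 𝕃 c))) →
        S.card ≤ φ.degree * (level w (V[W']) t ⊓ Rg[W']).relIndex Rg[W'] := by
  have hcv : 0 < w (algebraMap K 𝕃 c) :=
    pos_iff_ne_zero.mpr ((Valuation.ne_zero_iff w).mpr ((map_ne_zero (algebraMap K 𝕃)).mpr hc))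
  obtain ⟨t₁, ht₁, hdeep⟩ := exists_deep_preimage (w := w) hw hn hζ W W' ι φ hc hBad hBm hdeg hlc hφ
  refine ⟨t₁, ht₁, fun {t} ht hfin S hS hsep ↦ ?_⟩
  -- the map to the quotient
  let N : AddSubgroup ↥(Rg[W']) := (level w (V[W']) t ⊓ Rg[W']).addSubgroupOf Rg[W']
  haveI : Fintype (↥(Rg[W']) ⧸ N) := AddSubgroup.fintypeOfIndexNeZero hfin
  let θ : W.geomPoints → ↥(Rg[W']) ⧸ N := fun P ↦
    if h : ι⁎[W'] (φ P) ∈ Rg[W'] then QuotientAddGroup.mk ⟨_, h⟩ else 0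
  have hθ : ∀ P (hP : P ∈ S), θ P = QuotientAddGroup.mk
      ⟨ι⁎[W'] (φ P), emb_isogeny_mem_range hn hζ W W' ι φ (hS P hP)⟩ :=
    fun P hP ↦ dif_pos (emb_isogeny_mem_range hn hζ W W' ι φ (hS P hP))
  -- fibres have at most `#ker φ` elements
  have hfib : ∀ b ∈ S.image θ, (S.filter fun P ↦ θ P = b).card ≤ φ.degree := by
    intro b hb
    obtain ⟨P', hP'S, rfl⟩ := Finset.mem_image.mp hb
    -- for `P` in the fibre, a deep layer preimage of `φ (P - P')`
    have key : ∀ P ∈ S.filter (fun P ↦ θ P = θ P'), ∃ P₁ : W.geomPoints,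
        ι⁎[W] P₁ ∈ level w (V[W]) (t / w (algebraMap K 𝕃 c)) ∧ P - P' - P₁ ∈ φ.toAddMonoidHom.ker := by
      intro P hP
      obtain ⟨hPS, hPP'⟩ := Finset.mem_filter.mp hP
      rw [hθ P hPS, hθ P' hP'S, QuotientAddGroup.eq] at hPP'
      have hlev := (AddSubgroup.mem_inf.mp (AddSubgroup.mem_addSubgroupOf.mp hPP')).1
      have hlev' : ι⁎[W'] (φ (P - P')) ∈ level w (V[W']) t := by
        have h := neg_mem hlev
        rw [AddSubgroup.coe_add, AddSubgroup.coe_neg, neg_add, neg_neg, ← sub_eq_add_neg] at h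
        rw [map_sub, map_sub]; exact h
      have hmem : ι⁎[W] (P - P') ∈ Rg[W] := by rw [map_sub]; exact sub_mem (hS P hPS) (hS P' hP'S)
      obtain ⟨P₁, -, hP₁1, hP₁φ, hP₁z⟩ := hdeep (P - P') hmem hlev'.1 (lt_of_le_of_lt hlev'.2 ht)
      refine ⟨P₁, mem_level_iff.mpr ⟨hP₁1, ?_⟩, ?_⟩
      · rw [le_div_iff₀ hcv, mul_comm, hP₁z]; exact hlev'.2
      · rw [AddMonoidHom.mem_ker, WeierstrassCurve.Isogeny.coe_toAddMonoidHom, map_sub, hP₁φ, sub_self]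
    choose! π hπ using key
    -- `P ↦ P - P' - π P` is injective on the fibre, with values in `ker φ`
    have hinj : Set.InjOn (fun P ↦ P - P' - π P) (S.filter fun P ↦ θ P = θ P') := by
      intro P hP P₂ hP₂ he
      have hPS := (Finset.mem_filter.mp hP).1
      have hP₂S := (Finset.mem_filter.mp hP₂).1
      by_contra hne
      have hsub : P - P₂ = π P - π P₂ := by
        have h1 := he
        dsimp only at h1
        have h2 := sub_eq_sub_iff_sub_eq_sub.mp h1
        rwa [sub_sub_sub_cancel_right] at h2
      have : ι⁎[W] (P - P₂) ∈ level w (V[W]) (t / w (algebraMap K 𝕃 c)) := by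
        rw [hsub, map_sub]; exact sub_mem (hπ P hP).1 (hπ P₂ hP₂).1
      exact hsep P hPS P₂ hP₂S hne this
    calc (S.filter fun P ↦ θ P = θ P').card
        = ((S.filter fun P ↦ θ P = θ P').image fun P ↦ P - P' - π P).card :=
          (Finset.card_image_of_injOn hinj).symm
      _ ≤ (φ.finite_ker.toFinset).card := Finset.card_le_card (fun k hk ↦ by
          obtain ⟨P, hP, rfl⟩ := Finset.mem_image.mp hk
          exact φ.finite_ker.mem_toFinset.mpr (hπ P hP).2)
      _ = φ.degree := by
          rw [WeierstrassCurve.Isogeny.degree]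
          exact (Nat.card_eq_card_finite_toFinset φ.finite_ker).symm
  calc S.card ≤ φ.degree * (S.image θ).card := Finset.card_le_mul_card_image S _ hfib
    _ ≤ φ.degree * (level w (V[W']) t ⊓ Rg[W']).relIndex Rg[W'] := by
        gcongr
        calc (S.image θ).card ≤ Fintype.card (↥(Rg[W']) ⧸ N) := Finset.card_le_univ _
          _ = (level w (V[W']) t ⊓ Rg[W']).relIndex Rg[W'] := by
              rw [AddSubgroup.relIndex, AddSubgroup.index_eq_card, Nat.card_eq_fintype_card]

end IsDedekindDomain.HeightOneSpectrum

end
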